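import Summits.Ventures.HodgeRepro0.P6AokiQuotientLevel180Data4

/-!
# Aoki's quotient `B_q/(S_q + D_q)` at the level q = 180 — kernel certificate (part 9 of 15 — the rows 58 … 77 of `hℓexpr`)

The kernel-decided fact `hℓexpr` of `level_of_decided` on the rows `58 … 77` of the echelon basis (rows `58 + i`, `i < 20`).
-/

namespace HodgeRepro0.P6AokiQuotient

namespace L180
/-- level 180: the rows `58 + i`, `i < 20`, of the kernel-decided fact `hℓexpr`. -/
theorem fact_hellexpr_3 : ∀ i < 20, ellL.getD (58 + i) [] = lincombList (180 - 1) (List.zip (exprG.getD (58 + i) []) (exprC.getD (58 + i) [])) (genDenseL ++ betaL) := by decide +kernel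
end L180

end HodgeRepro0.P6AokiQuotient
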